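import Mathlib
import Summits.ValiantsHypothesis.ValiantsHypothesis.Theorems.FifoMatchingNNNotVPSupportFnCore
import Summits.ValiantsHypothesis.ValiantsHypothesis.Theorems.FifoMatchingNNLowDegreeCofactorHardStubCarveInterval
import Summits.ValiantsHypothesis.ValiantsHypothesis.Theorems.FifoMatchingNNDivisionHardCorSandwich
import Literature.Computability.AlgebraicComplexity.ValiantClassesProofs
import HarnessLib

/-!
# Route FifoMatching — crux `NNNotVP` (stmt-ValiantsHypothesis-11615), line `division_split`:
# stub A `stub_supportFnHard` ⟺ its free-arc-free core (interval carving)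

Registered line `Cruxes/NNNotVP/Lines/division_split.lean`; objects `σ` / `NN` / `SuppFn` /
`freeVars` = the line's vocabulary (`Theorems/FifoMatchingNNNotVPDivisionSplitDefs.lean`).

Stub **A** (`stub_supportFnHard`, verbatim below as hypothesis / conclusion) quantifies over every
set `T` of `≤ (log₂ n + k)^k` FREED arcs.  This file removes that layer BY NAME:

* `supportFnHard_of_core` — the `T = ∅` CORE («for all `c` and all large `n`, every nonnegative `g`
  with the support function of `NN_n` has `L₊(g) > 2^((log₂ n + c)^c)») implies stub A verbatim;
* `supportFnHard_iff_core` — with the companion's `core_of_supportFnHard`, stub A ⟺ its core.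

Proof (self-reduction of nest-free perfect-matching recognition under freed arcs).  The `≤ 2|T|`
endpoints `R` of the freed arcs miss one of `|R|+1` disjoint even-aligned blocks
`I = [2mj, 2mj+2m)`, `m = n/(|R|+1)` (`Carve.exists_free_block`).  Carve along `I`
(`Carve.Carving.subst`: arcs inside `I` keep their renamed variable, arcs crossing `∂I` die, all
other arcs — in particular every arc of `T` — are freed): this is a projection, so `L₊` does not
grow (`complexity_le_of_isProjection`), and it maps 0/1 points to 0/1 points, so it transports
SUPPORT FUNCTIONS (`suppFn_aeval_iff`, here `suppFn_carve_iff`): `g ↦ g'` with the support function of the carved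
`NN_n|_{T := 1}` = the carved `NN_n` (the arcs of `T` are freed anyway) — whose support is exactly
that of `NN_m` (restriction / extension of nest-free perfect matchings across an interval,
`Carve.Carving.filter_weight_eq`).  Finally `m ≥ √n - 1` eventually
(`CorSandwich.polylog_lt_rpow_eventually`), so `(log₂ n + c)^c ≤ (log₂ m + 2c+2)^(2c+2)` and the
core at `2c+2` gives the stub at `c`.

Honest framing: a reduction between two OPEN statements — stub A and its core (a
super-quasi-polynomial monotone BOOLEAN circuit lower bound for nest-free perfect-matching =
shuffle-square recognition on ordered graphs; NP-complete by Buss–Soltys 2014, no monotone lower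
bound in print); stubs Z / A / B2, the crux `NNNotVP` and `VP ≠ VNP` stay OPEN (NOT proved).
No definitions, no named facts.
-/

noncomputable section

-- Sub = Summit single-conjunct layout: the duplicated namespace component is mandated by the tree.
set_option linter.dupNamespace false

namespace Summit.ValiantsHypothesis.ValiantsHypothesis.Theorems.FifoMatching.NNNotVP.DivisionSplit

open MvPolynomial Finset Literature.Computability.AlgebraicComplexity
open Summit.ValiantsHypothesis.ValiantsHypothesis.Theorems.FifoMatching.NNLowDegreeCofactorHard.FreedVertices
open scoped NNReal BigOperators Classical

/-! ### Carving transports support functions -/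

section Carving

variable {n : ℕ} (C : Carve.Carving n)

/-- **Carving transports the support function**: `SuppFn (g carved) A' ↔ SuppFn g (pull-back of A')`,
the pull-back of `A'` being the arcs inside `I` whose renaming lies in `A'` together with all arcs
avoiding `I` (the carving substitution maps the 0/1 point `1_{A'}` to the 0/1 point of that set).
[folklore] -/
theorem suppFn_carve_iff (g : MvPolynomial (σ n) ℝ≥0) (A' : Finset (σ C.m)) :
    SuppFn (aeval C.subst g) A' ↔
      SuppFn g (univ.filter fun e : σ n =>
        (e.1 ∈ C.I ∧ e.2 ∈ C.I ∧ (C.dn e.1, C.dn e.2) ∈ A') ∨ (e.1 ∉ C.I ∧ e.2 ∉ C.I)) := by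
  refine suppFn_aeval_iff _ g A' _ fun e => ?_
  unfold Carve.Carving.subst
  simp only [mem_filter, mem_univ, true_and]
  by_cases h1 : e.1 ∈ C.I <;> by_cases h2 : e.2 ∈ C.I
  · simp only [h1, h2, and_self, if_true, eval_X, true_and, not_true_eq_false, or_false]
    split_ifs <;> rfl
  · simp [h1, h2]
  · simp [h1, h2]
  · simp [h1, h2]

/-- Carving with no freed vertex is the plain carving substitution. [folklore] -/
theorem aeval_subst_eq_substR_empty (p : MvPolynomial (σ n) ℝ≥0) :
    aeval C.subst p = aeval (C.substR ∅) p := by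
  have h := C.aeval_subst_aeval_free ∅ p
  have hX : (fun e : Fin (2 * n) × Fin (2 * n) =>
      if e.1 ∈ (∅ : Finset (Fin (2 * n))) ∨ e.2 ∈ (∅ : Finset (Fin (2 * n))) then
        (1 : MvPolynomial (Fin (2 * n) × Fin (2 * n)) ℝ≥0) else X e) = X := by
    funext e
    rw [if_neg (by simp)]
  rw [hX, aeval_X_left, AlgHom.id_apply] at h
  exact h

/-- **The carved `NN_n` has exactly the support of `NN_m`** (no freed vertex: a nest-free perfect
matching survives the carving iff it maps `I` to itself, and then restricts to one of `I ≅ [2m]`;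
conversely every one of `[2m]` extends by consecutive pairs). [folklore] -/
theorem support_aeval_subst_NN : (aeval C.subst (NN n)).support = (NN C.m).support := by
  rw [aeval_subst_eq_substR_empty,
    C.support_aeval_substR (R := ∅) (fun i _ => Finset.notMem_empty i)]
  rw [show (NN C.m).support = (nestFreeMatchings (2 * C.m)).image arcExponent from
      support_nestFreeMatchingPoly C.m, ← C.filter_weight_eq (R := ∅)]
  symm
  apply Finset.filter_true_of_mem
  intro d hd
  obtain ⟨M, hM, rfl⟩ := mem_image.1 hd
  obtain ⟨hMnf, hout⟩ := mem_filter.1 hM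
  have hperf := nestFreeMatchings_subset_perfectMatchings hMnf
  obtain ⟨hinv, -⟩ := mem_perfectMatchings.1 hperf
  have hI : ∀ j, M (C.up j) ∈ C.I := by
    intro j
    by_contra hj
    exact Finset.notMem_empty _ (hout (M (C.up j)) hj (by rw [hinv]; exact C.up_mem_I j))
  have hperf' : C.restrict M ∈ perfectMatchings (2 * C.m) :=
    nestFreeMatchings_subset_perfectMatchings (C.restrict_mem_nestFreeMatchings hMnf hI)
  rw [C.rexp_eq_arcExponent hI, arcExponent, Carve.weight_one_sum_single, card_openers hperf']

/-- Carving is a projection: it does not increase `L₊`. [folklore] -/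
theorem complexity_carve_le (g : MvPolynomial (σ n) ℝ≥0) :
    complexity (aeval C.subst g) ≤ complexity g :=
  complexity_le_of_isProjection (C.isProjection_aeval_subst g)

end Carving

/-! ### Arithmetic of the rate -/

/-- Halving the logarithm costs a doubled exponent: `(2x+1+c)^c ≤ (x+2c+2)^(2c+2)`. [folklore] -/
theorem polylog_halving (x c : ℕ) : (2 * x + 1 + c) ^ c ≤ (x + (2 * c + 2)) ^ (2 * c + 2) := by
  have h1 : 2 * x + 1 + c ≤ (x + (2 * c + 2)) ^ 2 := by nlinarith
  calc (2 * x + 1 + c) ^ c ≤ ((x + (2 * c + 2)) ^ 2) ^ c := Nat.pow_le_pow_left h1 c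
    _ ≤ ((x + (2 * c + 2)) ^ 2) ^ (c + 1) :=
        Nat.pow_le_pow_right (by positivity) (Nat.le_succ c)
    _ = (x + (2 * c + 2)) ^ (2 * c + 2) := by rw [← pow_mul]; ring_nf

/-- Eventually `(2(log₂ n + k)^k + 1)² ≤ n` (a polylog is below `n^{1/4}`). [folklore] -/
theorem eventually_sq_polylog_le (k : ℕ) :
    ∃ n₀ : ℕ, ∀ n ≥ n₀, (2 * (Nat.log 2 n + k) ^ k + 1) * (2 * (Nat.log 2 n + k) ^ k + 1) ≤ n := by
  obtain ⟨h₀, hh₀⟩ := CorSandwich.polylog_lt_rpow_eventually k (c := 1 / 4) (by norm_num)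
  refine ⟨max h₀ 81, fun n hn => ?_⟩
  have hn0 : h₀ ≤ n := le_trans (le_max_left _ _) hn
  have hn81 : (81 : ℝ) ≤ n := by exact_mod_cast le_trans (le_max_right _ _) hn
  have hq0 : (0 : ℝ) ≤ (n : ℝ) ^ (1 / 4 : ℝ) := Real.rpow_nonneg (Nat.cast_nonneg n) _
  have hq4 : ((n : ℝ) ^ (1 / 4 : ℝ)) ^ 4 = (n : ℝ) := by
    rw [← Real.rpow_natCast, ← Real.rpow_mul (Nat.cast_nonneg n)]
    norm_num
  have hq3 : (3 : ℝ) ≤ (n : ℝ) ^ (1 / 4 : ℝ) := by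
    by_contra hlt
    push Not at hlt
    have h := pow_lt_pow_left₀ hlt hq0 (n := 4) (by norm_num)
    have h81 : (3 : ℝ) ^ 4 = 81 := by norm_num
    rw [hq4, h81] at h
    linarith
  have hP : (((Nat.log 2 n + k) ^ k : ℕ) : ℝ) < (n : ℝ) ^ (1 / 4 : ℝ) := hh₀ n hn0
  have hr : ((2 * (Nat.log 2 n + k) ^ k + 1 : ℕ) : ℝ) ≤ 3 * (n : ℝ) ^ (1 / 4 : ℝ) := by
    push_cast at hP ⊢
    linarith
  have hfin : ((2 * (Nat.log 2 n + k) ^ k + 1 : ℕ) : ℝ) * ((2 * (Nat.log 2 n + k) ^ k + 1 : ℕ) : ℝ)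
      ≤ (n : ℝ) := by
    have hr0 : (0 : ℝ) ≤ ((2 * (Nat.log 2 n + k) ^ k + 1 : ℕ) : ℝ) := Nat.cast_nonneg _
    calc ((2 * (Nat.log 2 n + k) ^ k + 1 : ℕ) : ℝ) * ((2 * (Nat.log 2 n + k) ^ k + 1 : ℕ) : ℝ)
        ≤ (3 * (n : ℝ) ^ (1 / 4 : ℝ)) * (3 * (n : ℝ) ^ (1 / 4 : ℝ)) :=
          mul_le_mul hr hr hr0 (by positivity)
      _ = 9 * ((n : ℝ) ^ (1 / 4 : ℝ)) ^ 2 := by ring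
      _ ≤ ((n : ℝ) ^ (1 / 4 : ℝ)) ^ 2 * ((n : ℝ) ^ (1 / 4 : ℝ)) ^ 2 := by
          apply mul_le_mul_of_nonneg_right _ (by positivity)
          nlinarith
      _ = ((n : ℝ) ^ (1 / 4 : ℝ)) ^ 4 := by ring
      _ = (n : ℝ) := hq4
  exact_mod_cast hfin

/-! ### The core implies stub A -/

/-- **The free-arc-free core implies stub A (`stub_supportFnHard`, verbatim).**  Given `k, c`, run
the core at `2c+2` (threshold `n₁`); for `n` large, `T` with `|T| ≤ (log₂ n + k)^k` and `g` with
the support function of `NN_n|_{T := 1}`: the endpoints `R` of `T` (`|R| ≤ 2|T|`) miss an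
even-aligned block of half-length `m = n/(|R|+1) ≥ 2^(⌊log₂ n⌋/2) ≥ n₁`; carving `g` along it gives
`g'` over the arcs of `[2m]` with the support function of `NN_m` and `L₊(g') ≤ L₊(g)`, so
`2^((log₂ n + c)^c) ≤ 2^((log₂ m + 2c+2)^(2c+2)) < L₊(g') ≤ L₊(g)`. [folklore] -/
theorem supportFnHard_of_core
    (hA₀ : ∀ c : ℕ, ∃ n₀ : ℕ, ∀ n ≥ n₀, ∀ g : MvPolynomial (σ n) ℝ≥0,
      (∀ A : Finset (σ n), SuppFn g A ↔ SuppFn (NN n) A) →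
        2 ^ ((Nat.log 2 n + c) ^ c) < complexity g) :
    ∀ k c : ℕ, ∃ n₀ : ℕ, ∀ n ≥ n₀, ∀ T : Finset (σ n), T.card ≤ (Nat.log 2 n + k) ^ k →
      ∀ g : MvPolynomial (σ n) ℝ≥0, (∀ A : Finset (σ n), SuppFn g A ↔ SuppFn (freeVars T (NN n)) A) →
        2 ^ ((Nat.log 2 n + c) ^ c) < complexity g := by
  intro k c
  obtain ⟨n₁, hn₁⟩ := hA₀ (2 * c + 2)
  obtain ⟨n₂, hn₂⟩ := eventually_sq_polylog_le k
  refine ⟨max n₂ (2 ^ (2 * (Nat.log 2 n₁ + 1) + 2)), fun n hn T hT g hg => ?_⟩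
  have hn2 : n₂ ≤ n := le_trans (le_max_left _ _) hn
  have hnL : 2 ^ (2 * (Nat.log 2 n₁ + 1) + 2) ≤ n := le_trans (le_max_right _ _) hn
  have hnpos : 0 < n := lt_of_lt_of_le (Nat.two_pow_pos _) hnL
  -- the freed vertices
  obtain ⟨R, hRT⟩ : ∃ R : Finset (Fin (2 * n)), R = T.biUnion (fun e => {e.1, e.2}) := ⟨_, rfl⟩
  have hRcard : R.card ≤ 2 * (Nat.log 2 n + k) ^ k := by
    rw [hRT]
    calc (T.biUnion (fun e => {e.1, e.2})).card ≤ ∑ e ∈ T, ({e.1, e.2} : Finset (Fin (2 * n))).card :=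
          card_biUnion_le
      _ ≤ ∑ e ∈ T, 2 := sum_le_sum fun e _ => card_le_two
      _ = 2 * T.card := by rw [sum_const, smul_eq_mul, mul_comm]
      _ ≤ 2 * (Nat.log 2 n + k) ^ k := Nat.mul_le_mul_left 2 hT
  have hmemR : ∀ e ∈ T, e.1 ∈ R ∧ e.2 ∈ R := fun e he => by
    rw [hRT]
    exact ⟨mem_biUnion.2 ⟨e, he, by simp⟩, mem_biUnion.2 ⟨e, he, by simp⟩⟩
  -- the block half-length `m = n / (|R|+1)`
  obtain ⟨m, hm_eq⟩ : ∃ m, m = n / (R.card + 1) := ⟨_, rfl⟩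
  have hsq : (R.card + 1) * (R.card + 1) ≤ n := by
    refine le_trans (Nat.mul_le_mul ?_ ?_) (hn₂ n hn2) <;> omega
  have hRm : R.card + 1 ≤ m := by
    rw [hm_eq]
    exact (Nat.le_div_iff_mul_le (Nat.succ_pos _)).2 hsq
  have hmpos : 0 < m := by omega
  have hlt : n < (R.card + 1) * (m + 1) := by
    rw [hm_eq]
    exact Nat.lt_mul_div_succ n (Nat.succ_pos R.card)
  have hnm : n < (m + 1) * (m + 1) :=
    lt_of_lt_of_le hlt (Nat.mul_le_mul_right _ (by omega))
  -- `2^(⌊log₂ n⌋/2) ≤ m`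
  have h2L : 2 ^ Nat.log 2 n ≤ n := Nat.pow_log_le_self 2 (by omega)
  have hmL : 2 ^ (Nat.log 2 n / 2) ≤ m := by
    by_contra hcon
    push Not at hcon
    have h1 : m + 1 ≤ 2 ^ (Nat.log 2 n / 2) := hcon
    have h2 : (m + 1) * (m + 1) ≤ 2 ^ (Nat.log 2 n / 2) * 2 ^ (Nat.log 2 n / 2) :=
      Nat.mul_le_mul h1 h1
    have h3 : 2 ^ (Nat.log 2 n / 2) * 2 ^ (Nat.log 2 n / 2) ≤ 2 ^ Nat.log 2 n := by
      rw [← pow_add]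
      exact Nat.pow_le_pow_right (by norm_num) (by omega)
    omega
  have hlogm : Nat.log 2 n / 2 ≤ Nat.log 2 m := Nat.le_log_of_pow_le (by norm_num) hmL
  have hLge : 2 * (Nat.log 2 n₁ + 1) + 2 ≤ Nat.log 2 n := Nat.le_log_of_pow_le (by norm_num) hnL
  have hm1 : n₁ ≤ m := by
    have h1 : 2 ^ (Nat.log 2 n₁ + 1) ≤ 2 ^ (Nat.log 2 n / 2) :=
      Nat.pow_le_pow_right (by norm_num) (by omega)
    have h2 : n₁ < 2 ^ (Nat.log 2 n₁ + 1) := Nat.lt_pow_succ_log_self (by norm_num) n₁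
    omega
  -- the carving block, missing `R`
  obtain ⟨j, hj, hfree⟩ := Carve.exists_free_block R hmpos
  have hmn : (R.card + 1) * m ≤ n := by
    rw [hm_eq]
    exact Nat.mul_div_le n (R.card + 1)
  have hmj : m * j + m ≤ n :=
    calc m * j + m ≤ m * R.card + m := Nat.add_le_add_right (Nat.mul_le_mul_left m hj) m
      _ = (R.card + 1) * m := by ring
      _ ≤ n := hmn
  have hle : 2 * m * j + 2 * m ≤ 2 * n :=
    calc 2 * m * j + 2 * m = 2 * (m * j + m) := by ring
      _ ≤ 2 * n := by omega
  have heven : (2 * m * j) % 2 = 0 := by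
    rw [Nat.mul_assoc]
    exact Nat.mul_mod_right 2 _
  let Cv : Carve.Carving n := ⟨2 * m * j, m, hle, hmpos, heven⟩
  have hRI : ∀ i ∈ Cv.I, i ∉ R := fun i hi hiR => hfree i hiR (Cv.mem_I.1 hi)
  have hTout : ∀ e ∈ T, e.1 ∉ Cv.I ∧ e.2 ∉ Cv.I := fun e he =>
    ⟨fun h => hRI _ h (hmemR e he).1, fun h => hRI _ h (hmemR e he).2⟩
  -- the pulled-back arc sets contain `T`
  have hB : ∀ A' : Finset (σ Cv.m), ∃ B : Finset (σ n),
      (∀ p : MvPolynomial (σ n) ℝ≥0, SuppFn (aeval Cv.subst p) A' ↔ SuppFn p B) ∧ T ⊆ B :=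
    fun A' => ⟨_, fun p => suppFn_carve_iff Cv p A',
      fun e he => mem_filter.2 ⟨mem_univ _, Or.inr (hTout e he)⟩⟩
  -- the carved polynomial has the support function of `NN_m`
  have hg' : ∀ A' : Finset (σ Cv.m),
      SuppFn (aeval Cv.subst g) A' ↔ SuppFn (NN Cv.m) A' := by
    intro A'
    obtain ⟨B, hBiff, hTB⟩ := hB A'
    rw [hBiff g, hg B, suppFn_freeVars_iff_of_subset hTB, ← hBiff (NN n),
      suppFn_iff_of_support_eq (support_aeval_subst_NN Cv) A']
  -- the core at `m`, and the rate
  have hcore : 2 ^ ((Nat.log 2 m + (2 * c + 2)) ^ (2 * c + 2)) < complexity (aeval Cv.subst g) :=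
    hn₁ m hm1 (aeval Cv.subst g) hg'
  have harith : (Nat.log 2 n + c) ^ c ≤ (Nat.log 2 m + (2 * c + 2)) ^ (2 * c + 2) :=
    calc (Nat.log 2 n + c) ^ c ≤ (2 * (Nat.log 2 n / 2) + 1 + c) ^ c :=
          Nat.pow_le_pow_left (by omega) c
      _ ≤ (Nat.log 2 n / 2 + (2 * c + 2)) ^ (2 * c + 2) := polylog_halving _ c
      _ ≤ (Nat.log 2 m + (2 * c + 2)) ^ (2 * c + 2) := Nat.pow_le_pow_left (by omega) _
  calc 2 ^ ((Nat.log 2 n + c) ^ c)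
      ≤ 2 ^ ((Nat.log 2 m + (2 * c + 2)) ^ (2 * c + 2)) := Nat.pow_le_pow_right (by norm_num) harith
    _ < complexity (aeval Cv.subst g) := hcore
    _ ≤ complexity g := complexity_carve_le Cv g

/-- **Stub A ⟺ its free-arc-free core** (the registered `stub_supportFnHard`, verbatim on the
left; `core_of_supportFnHard` / `supportFnHard_of_core`).  Both sides are OPEN. [folklore] -/
theorem supportFnHard_iff_core :
    (∀ k c : ℕ, ∃ n₀ : ℕ, ∀ n ≥ n₀, ∀ T : Finset (σ n), T.card ≤ (Nat.log 2 n + k) ^ k →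
      ∀ g : MvPolynomial (σ n) ℝ≥0, (∀ A : Finset (σ n), SuppFn g A ↔ SuppFn (freeVars T (NN n)) A) →
        2 ^ ((Nat.log 2 n + c) ^ c) < complexity g) ↔
    (∀ c : ℕ, ∃ n₀ : ℕ, ∀ n ≥ n₀, ∀ g : MvPolynomial (σ n) ℝ≥0,
      (∀ A : Finset (σ n), SuppFn g A ↔ SuppFn (NN n) A) →
        2 ^ ((Nat.log 2 n + c) ^ c) < complexity g) :=
  ⟨core_of_supportFnHard, supportFnHard_of_core⟩

end Summit.ValiantsHypothesis.ValiantsHypothesis.Theorems.FifoMatching.NNNotVP.DivisionSplit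

end
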